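import Literature.Probability.Percolation.SeedExploration
import HarnessLib

/-!
# The OSSS one-arm variance inequality for product measures (Duminil-Copin–Raoufi–Tassion, Lemma 3.2)

Source: H. Duminil-Copin, A. Raoufi, V. Tassion, Ann. of Math. 189 (2019), §3, Lemma 3.2 and its proof
("we obtain the target inequality by applying Theorem 1.1 [OSSS] for each `k` and then summing on `k`"),
in the special case of a PRODUCT measure on the edges of a finite graph (the case `q = 1` of their
Theorem 1.2; H. Duminil-Copin, arXiv:1810.03384, Lemma 3.8).  Setting: a finite edge-labelled graph
(`W`, `E`, `edge : W → W → Option E` symmetric with unique endpoints), biases `p : E → [0,1]`, a source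
`o`, a target set `B` and ONE seed set `Z` separating `o` from `B` (`SeedExploration.Separates`).  With
`A = P(o ↔ B) = ∑_y w(y)·𝟙{o ↔ B}(y)`, the two-function OSSS inequality (`osss_cov_strategy`,
O'Donnell–Saks–Schramm–Servedio 2005) for the seed-exploration tree of `SeedExploration.lean`, applied to
`g = G = 2·𝟙{o↔B} − 1`, gives

  `A − A² ≤ ∑_e R(e) · p_e(1 − p_e) · P(e pivotal for {o ↔ B})`     (`variance_le_sum_revealment_mul_piv`)

for any majorant `R(e) ≥ P(a ↔ Z) + P(b ↔ Z)` of the revealment of the edge `e = ab`.  Summation over a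
family of seed sets (`∂Λ_k`, `k = 1,…,n`) and the lattice bookkeeping are done in `OneArmOSSSDiffIneqZd.lean`.
-/

namespace Literature.Probability.Percolation

open Finset Function Literature.Probability.ODonnellSaksSchrammServedio2005
open Literature.Probability.ODonnellSaksSchrammServedio2005.Strategy
open GhostExploration

namespace SeedExploration

variable {W E : Type*} {edge : W → W → Option E}

variable (edge) in
open Classical in
/-- The indicator `𝟙{o ↔ B}` on edge configurations. [cite: DuminilCopinRaoufiTassion2019, §3 Lemma 3.2 (the function 𝟙_{0↔∂Λ_n})] -/
noncomputable def garm (o : W) (B : Set W) (y : E → Bool) : ℝ := if Conn edge o B y then 1 else 0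

/-- `gpm = 2·garm − 1`. [cite: DuminilCopinRaoufiTassion2019, §3 Lemma 3.2 (the function 𝟙_{0↔∂Λ_n})] -/
theorem gpm_eq (o : W) (B : Set W) (y : E → Bool) : gpm edge o B y = 2 * garm edge o B y - 1 := by
  unfold gpm garm; split_ifs <;> norm_num

/-- `garm ∈ {0,1}`: `garm² = garm`. [cite: DuminilCopinRaoufiTassion2019, §3 Lemma 3.2 (𝟙_{0↔∂Λ_n} is Boolean)] -/
theorem garm_mul_self (o : W) (B : Set W) (y : E → Bool) :
    garm edge o B y * garm edge o B y = garm edge o B y := by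
  unfold garm; split_ifs <;> norm_num

variable [DecidableEq E]

/-- `𝟙{o ↔ B}` is increasing in each edge: `garm(y^{e→0}) ≤ garm(y^{e→1})`.
[cite: DuminilCopinRaoufiTassion2019, §3 Lemma 3.2 (𝟙_{0↔∂Λ_n} is increasing)] -/
theorem garm_update_false_le (o : W) (B : Set W) (y : E → Bool) (e : E) :
    garm edge o B (update y e false) ≤ garm edge o B (update y e true) := by
  have hmono : Conn edge o B (update y e false) → Conn edge o B (update y e true) := by
    rintro ⟨b, hb, hr⟩
    refine ⟨b, hb, yReach_mono (fun e' he' => ?_) hr⟩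
    by_cases hee : e' = e
    · subst hee; simp at he'
    · rwa [update_of_ne hee] at he' ⊢
  unfold garm
  by_cases hf : Conn edge o B (update y e false)
  · rw [if_pos hf, if_pos (hmono hf)]
  · rw [if_neg hf]; split_ifs <;> norm_num

variable [Fintype W] [Fintype E]

variable (edge) in
open Classical in
/-- `P(a ↔ Z) = ∑_x w(x)·𝟙{a ↔ Z}(x)`, the probability that `a` is joined to the seed set.
[cite: DuminilCopinRaoufiTassion2019, §3 Lemma 3.2 (μ[u ↔ ∂Λ_k])] -/
noncomputable def seedProb (p : E → ℝ) (Z : Set W) (a : W) : ℝ :=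
  ∑ x, wt p x * (if SeedConn edge Z x a then 1 else 0)

variable (edge) in
/-- `P(e pivotal for {o ↔ B}) = E[𝟙(y^{e→1}) − 𝟙(y^{e→0})]`.
[cite: DuminilCopinRaoufiTassion2019, §3 proof of Thm 1.2 (Cov(𝟙_{0↔∂Λ_n}, ω_e) and the derivative formula)] -/
noncomputable def pivArm (p : E → ℝ) (o : W) (B : Set W) (e : E) : ℝ :=
  ∑ y, wt p y * (garm edge o B (update y e true) - garm edge o B (update y e false))

omit [Fintype W] in
/-- `P(e pivotal) ≥ 0`. [cite: DuminilCopinRaoufiTassion2019, §3 Lemma 3.2 (𝟙_{0↔∂Λ_n} is increasing)] -/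
theorem pivArm_nonneg {p : E → ℝ} (h0 : ∀ i, 0 ≤ p i) (h1 : ∀ i, p i ≤ 1) (o : W) (B : Set W)
    (e : E) : 0 ≤ pivArm edge p o B e :=
  Finset.sum_nonneg fun y _ => mul_nonneg (wt_nonneg h0 h1 y)
    (sub_nonneg.2 (garm_update_false_le o B y e))

omit [Fintype W] in
/-- Influence of an edge on `2·𝟙{o↔B} − 1`: `Inf_e[2𝟙−1] = 4 p_e(1−p_e) · P(e pivotal)`.
[cite: OdonnellEtAl2005, §3.1 p. 6 (Inf^{ρ₁} for Boolean-valued coordinates)] -/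
theorem infl_gpm (p : E → ℝ) (o : W) (B : Set W) (e : E) :
    infl p e (gpm edge o B) = 4 * (p e * (1 - p e)) * pivArm edge p o B e := by
  rw [infl_eq]
  have hx : ∀ y : E → Bool,
      |gpm edge o B (update y e true) - gpm edge o B (update y e false)|
        = 2 * (garm edge o B (update y e true) - garm edge o B (update y e false)) := by
    intro y
    rw [gpm_eq, gpm_eq]
    have hle := garm_update_false_le (edge := edge) o B y e
    rw [abs_of_nonneg (by linarith)]
    ring
  simp_rw [hx]
  unfold pivArm
  simp only [Finset.mul_sum]
  exact Finset.sum_congr rfl fun y _ => by ring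

open Classical in
/-- THE OSSS ONE-ARM VARIANCE INEQUALITY FOR ONE SEED SET (Duminil-Copin–Raoufi–Tassion, proof of
Lemma 3.2, product measure): if `Z` separates `o` from `B` and `R(e) ≥ P(a ↔ Z) + P(b ↔ Z)` for every edge
`e = ab` (and `R ≥ 0`), then with `A = P(o ↔ B)`,
`A − A² ≤ ∑_e R(e) · p_e(1−p_e) · P(e pivotal for {o ↔ B})`.
[cite: DuminilCopinRaoufiTassion2019, §3 Lemma 3.2 and its proof (OSSS applied to the tree T of ∂Λ_k)] -/
theorem variance_le_sum_revealment_mul_piv (hsymm : ∀ a b, edge a b = edge b a)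
    (hends : ∀ e a b a' b', edge a b = some e → edge a' b' = some e → a' = a ∨ a' = b)
    (p : E → ℝ) (h0 : ∀ e, 0 ≤ p e) (h1 : ∀ e, p e ≤ 1) {Z : Set W} {o : W} {B : Set W}
    (hsep : Separates edge Z o B) {R : E → ℝ} (hR0 : ∀ e, 0 ≤ R e)
    (hR : ∀ e a b, edge a b = some e → seedProb edge p Z a + seedProb edge p Z b ≤ R e) :
    (∑ y, wt p y * garm edge o B y) - (∑ y, wt p y * garm edge o B y) ^ 2
      ≤ ∑ e, R e * (p e * (1 - p e)) * pivArm edge p o B e := by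
  -- OSSS for the seed-exploration strategy, with `g = G = 2·𝟙 − 1`
  have osss := osss_cov_strategy p h0 h1 (strategy_legal edge Z) (label edge Z o B) (abs_gpm_le edge o B)
    (fun σ x hc hh => label_eq_of_halt hsymm hsep σ x hc hh) (gpm edge o B)
  -- left side = 4 (A − A²)
  have hlhs : (∑ y, wt p y * (gpm edge o B y * gpm edge o B y))
      - (∑ y, wt p y * gpm edge o B y) * (∑ y, wt p y * gpm edge o B y)
      = 4 * ((∑ y, wt p y * garm edge o B y) - (∑ y, wt p y * garm edge o B y) ^ 2) := by
    simp only [gpm_eq]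
    rw [cov_two_mul_sub_one p (garm edge o B) (garm edge o B)]
    simp only [garm_mul_self]
    ring
  rw [hlhs] at osss
  -- revealment of an edge coordinate is at most `R e`
  have hrev : ∀ e, revealment p (strategy edge Z) (label edge Z o B) e ≤ R e := by
    intro e
    by_cases hex : ∃ a b, edge a b = some e
    · obtain ⟨a₀, b₀, hab⟩ := hex
      refine (revealment_edge_le p h0 h1 Z o B e a₀ b₀
        (fun a b hab' => hends e a₀ b₀ a b hab hab')).trans ?_
      exact hR e a₀ b₀ hab
    · push Not at hex
      exact (revealment_edge_le_zero p h0 h1 Z o B e hex).trans (hR0 e)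
  -- right side
  have hrhs : ∑ e, revealment p (strategy edge Z) (label edge Z o B) e * infl p e (gpm edge o B)
      ≤ ∑ e, R e * (4 * (p e * (1 - p e)) * pivArm edge p o B e) := by
    refine Finset.sum_le_sum fun e _ => ?_
    rw [← infl_gpm p o B e]
    exact mul_le_mul_of_nonneg_right (hrev e) (infl_nonneg h0 h1 _ _)
  have hfin := osss.trans hrhs
  have hsum : ∑ e, R e * (4 * (p e * (1 - p e)) * pivArm edge p o B e)
      = 4 * ∑ e, R e * (p e * (1 - p e)) * pivArm edge p o B e := by
    rw [Finset.mul_sum]; exact Finset.sum_congr rfl fun e _ => by ring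
  rw [hsum] at hfin
  linarith

end SeedExploration

end Literature.Probability.Percolation
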